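import Literature.NumberTheory.QuadraticFields.OesterleAmplification
import Literature.NumberTheory.EllipticCurves.BSDHeegnerPointsSignEvenProofs
import Literature.NumberTheory.EllipticCurves.TwistRootNumberModularityProofs
import Literature.NumberTheory.EllipticCurves.BSDRootNumberOddParityProofs
import HarnessLib

/-!
# The yield of the Goldfeld–Oesterlé–Iwaniec amplification as a function of the provable order

Topic `NumberTheory/QuadraticFields` (namespace `Literature.NumberTheory.QuadraticFields`).
Companion of `OesterleAmplification.lean`, which types Iwaniec's order-`m` exponent law
(*Conversations on the exceptional character*, LNM 1891 (2006), Thm 4.1) as the named fact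
`Iwaniec2006_theorem_4_1_weightTwo` (elliptic-curve case): if `L(s) = L(s,f)L(s,f_χ)` vanishes at
the centre to order `m ≥ 3` then `h(−D) ≫ θ(D)(log D)^{g−1}`, `g ∈ {m−1, m−2}`,
`(−1)^g = w = w(E)·w(E^{(D)})`.

This file turns the «yield column» of the Goldfeld census (what effective class-number bound a
curve of PROVABLE analytic rank `r₀` would give) into kernel-checked statements, conditional on
exactly two named facts taken as hypotheses — Iwaniec's theorem and the Modularity Theorem
`exists_isNewformOf` (Breuil–Conrad–Diamond–Taylor 2001; needed only for the sign of the twisted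
functional equation) — and on the analytic-rank hypothesis `r₀ ≤ ord_{s=1} L(E, s)` carried as a
hypothesis (it is certifiable today only for `r₀ ≤ 3`, Gross–Zagier 1986 / Buhler–Gross–Zagier
1985). Results:

* `exists_twistCharacter_of_coprime_discr` — for ANY imaginary quadratic `K` with `(d_K, N) = 1`
  the Kronecker character `χ` of `K` is primitive quadratic mod `|d_K|`, twists `E` into `E^{(d_K)}`
  coefficientwise and is odd, `χ(−1) = −1` (the Heegner-hypothesis versions
  `exists_twistCharacter_of_odd_discr` / `_of_four_dvd_discr` of the tree assume all `p ∣ N` split;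
  here nothing is assumed on the splitting, and nothing is claimed about `χ(N)`).
* `rootNumber_quadraticTwist_discr_eq_neg_of_isSquare_conductorNorm` — **square level**: if
  `N = M²` then `w(E^{(d_K)}) = −w(E)` for EVERY imaginary quadratic `K` prime to `N`
  (`χ(−N) = χ(−1)χ(M)² = −1`; Iwaniec (4.10) «w(f_χ) = χ(−N)w(f)» read at square level;
  Murty–Murty 1997, Ch. 6 §1).
* `le_classNumber_logPow_of_le_analyticRank` — **the exponent law** `E = r₀ + δ − 3` of the census
  (`δ = 1` on the class `w(E^{(d_K)}) = −1`, `δ = 0` on the class `w(E^{(d_K)}) = +1`): from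
  `r₀ ≤ r_an(E)`, `(−1)^{r₀} = w(E)`, `r₀ ≥ 3`, one constant `c = c(E, r₀) > 0` with
  `c·θ(d)·(log d)^{r₀−2} ≤ h(−d)` on the first class and `c·θ(d)·(log d)^{r₀−3} ≤ h(−d)` on the second.
* `le_classNumber_logSq_of_four_le_analyticRank_of_isSquare_conductorNorm` — **the target shape**:
  ONE elliptic curve over `ℚ` with square conductor, `w = +1` and provable analytic rank `≥ 4`
  gives `c·θ(d)(log d)² ≤ h(−d)` for ALL imaginary quadratic `d` prime to `N` (the whole
  coprime family is the favourable class).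
* `le_classNumber_logSq_of_four_le_analyticRank` (any level: `(log d)²` on the class
  `w(E^{(d_K)}) = −1`, `(log d)` on the other) and `le_classNumber_logSq_of_five_le_analyticRank`
  (`r₀ = 5`, `w = −1`: `(log d)²` for all coprime `d`).

For comparison, the theorem of record (Oesterlé 1985, Thm 1, via the rank-3 curve 5077a) is the
case `r₀ = 3`, `w = −1`: exponent `1` on the class `w(E^{(d)}) = −1` and `0` on the other (there
rescued by the elementary split-prime bound, `OesterleSplitPrimeBound.lean`). No definition and no
named fact is introduced (D-0026); `iwaniecTheta_pos` records `θ(D) > 0`.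

## References

* [IwaniecConversations2006] H. Iwaniec, *Conversations on the exceptional character*, in:
  Analytic Number Theory (Cetraro 2002), LNM 1891, Springer 2006, §4, (4.10), (4.14), Thm 4.1
  (held: corpus book:friedlandernd-analytic-number-theory p. 89–91).
* [Goldfeld1976] D. Goldfeld, Ann. Scuola Norm. Sup. Pisa (4) 3 (1976) 623–663, Thm 1
  (exponent `g − μ − 1`).
* [Oesterle1985] J. Oesterlé, Sém. Bourbaki 631, Astérisque 121–122 (1985) 309–323, Thm 1–2.
* [MurtyMurty1997] M. R. Murty, V. K. Murty, *Non-vanishing of L-functions and applications*,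
  Birkhäuser 1997, Ch. 6 §1 (sign `w χ_D(−N)` of the twisted functional equation).
* [BCDTJAMS2001] C. Breuil, B. Conrad, F. Diamond, R. Taylor, JAMS 14 (2001), Thm. A.
-/

noncomputable section

open scoped Classical NumberTheorySymbols

open WeierstrassCurve NumberField IsDedekindDomain Rat.HeightOneSpectrum
  Literature.NumberTheory.EllipticCurves Literature.NumberTheory.EllipticCurves.ModularForms

namespace Literature.NumberTheory.QuadraticFields

variable (W : WeierstrassCurve ℚ) (K : Type) [Field K] [NumberField K]

/-! ### The Kronecker character of an imaginary quadratic field prime to the conductor -/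

/-- **The Kronecker character of `K` twists `E` into `E^{(d_K)}` — no splitting hypothesis.** Let
`E / ℚ` be an elliptic curve (model `W`, conductor `N_W`) and `K` an imaginary quadratic field with
`(N_W, d_K) = 1`. Then there is a primitive quadratic Dirichlet character `χ` mod `m` with
`(N_W, m) = 1` (namely the Kronecker character `(d_K / ·)`, `m = |d_K|`: the Jacobi character for
odd `d_K`, the character `n ↦ (d_K/4 / n)` (`n` odd) mod `4|d_K/4|` for even `d_K`) such that
`aₙ(E^{(d_K)}) = χ(n) aₙ(E)` for all `n` and `χ(−1) = −1`. Same assembly as the tree's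
`exists_twistCharacter_of_odd_discr` / `exists_twistCharacter_of_four_dvd_discr` (Gross 1984, §5),
with the Heegner hypothesis replaced by bare coprimality (good reduction at the primes dividing
`d_K` is all the coefficient identity needs) and the value `χ(N_W)` left free.
[cite: IwaniecConversations2006, (4.10)–(4.14)] [cite: Gross1984, §5] -/
theorem exists_twistCharacter_of_coprime_discr [W.IsElliptic] (h2 : Module.finrank ℚ K = 2)
    (hneg : NumberField.discr K < 0)
    (hcop : (W.conductorNorm ℤ).Coprime (NumberField.discr K).natAbs) :
    ∃ (m : ℕ) (_ : NeZero m) (χ : DirichletCharacter ℂ m), (W.conductorNorm ℤ).Coprime m ∧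
      χ.IsQuadratic ∧ χ.IsPrimitive ∧
      (∀ n : ℕ, ((W.quadraticTwist (NumberField.discr K : ℚ)).LFunction n : ℂ) =
        χ n * (W.LFunction n : ℂ)) ∧
      χ (-1) = -1 := by
  set D : ℤ := NumberField.discr K with hDdef
  have hD0 : D ≠ 0 := NumberField.discr_ne_zero K
  -- good reduction of `W` at the primes dividing `D`, from `(N, D) = 1`
  have hgood : ∀ v : HeightOneSpectrum (𝓞 ℚ), ((primesEquiv v : ℕ) : ℤ) ∣ D →
      W.HasGoodReductionAt v := by
    intro v hv
    by_contra hbad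
    have hdvdN : (primesEquiv v : ℕ) ∣ W.conductorNorm ℤ := (W.dvd_conductorNorm_iff v).mpr hbad
    have hdvdD : (primesEquiv v : ℕ) ∣ D.natAbs := Int.natCast_dvd.mp hv
    exact (primesEquiv v).2.one_lt.ne'
      (Nat.Coprime.eq_one_of_dvd (Nat.Coprime.coprime_dvd_left hdvdN hcop) hdvdD)
  rcases Quadratic.isFundamentalDiscriminant_discr (K := K) h2 with ⟨hD4, hsq, -⟩ | ⟨h4, hm4, hsq⟩
  · -- odd discriminant: `χ = (· / |D|)`, `|D| ≡ 3 (mod 4)`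
    haveI : NeZero D.natAbs := ⟨Int.natAbs_ne_zero.mpr hD0⟩
    have hoddN : Odd D.natAbs := Int.natAbs_odd.mpr (Int.odd_iff.mpr (by omega))
    have hsqN : Squarefree D.natAbs := Int.squarefree_natAbs.mpr hsq
    have hq3 : D.natAbs % 4 = 3 := by omega
    refine ⟨D.natAbs, inferInstance, jacobiChar D.natAbs, hcop, isQuadratic_jacobiChar,
      isPrimitive_jacobiChar hoddN hsqN, fun n ↦ ?_, jacobiChar_neg_one_of_mod_four_eq_three hq3⟩
    rw [jacobiChar_natCast, W.LFunction_quadraticTwist_apply_of_emod_four_eq_one hD4 hsq hgood n]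
    push_cast
    rfl
  · -- even discriminant `D = 4m`, `m ≡ 2, 3 (mod 4)` squarefree: `χ(n) = (m / n)` for odd `n`
    have hDm : D = 4 * (D / 4) := (Int.mul_ediv_cancel' h4).symm
    have hm0 : D / 4 ≠ 0 := hsq.ne_zero
    have hmneg : D / 4 < 0 := by omega
    haveI : NeZero (4 * (D / 4).natAbs) :=
      ⟨mul_ne_zero (by norm_num) (Int.natAbs_ne_zero.mpr hm0)⟩
    have hDabs : D.natAbs = 4 * (D / 4).natAbs := by
      conv_lhs => rw [hDm]
      rw [Int.natAbs_mul]
      rfl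
    obtain ⟨χ, hχ⟩ := exists_dirichletCharacter_four_mul (D / 4) hm0
    have hcop' : (W.conductorNorm ℤ).Coprime (4 * (D / 4).natAbs) := hDabs ▸ hcop
    have hcoeff : ∀ n : ℕ, (W.quadraticTwist (D : ℚ)).LFunction n =
        (if Even n then 0 else J(D / 4 | n)) * W.LFunction n := fun n ↦
      W.LFunction_quadraticTwist_apply_of_four_dvd_discr K h2 h4 hgood n
    refine ⟨4 * (D / 4).natAbs, inferInstance, χ, hcop', isQuadratic_of_forall_odd hm0 hχ,
      isPrimitive_of_forall_odd hm4 hsq hχ, fun n ↦ ?_, apply_neg_one_of_forall_odd hmneg hm4 hχ⟩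
    rw [hcoeff n]
    by_cases hn : Even n
    · have hval : Even ((n : ZMod (4 * (D / 4).natAbs)).val) := by
        rw [ZMod.val_natCast, Nat.even_iff,
          Nat.mod_mod_of_dvd n (⟨2 * (D / 4).natAbs, by ring⟩ : 2 ∣ 4 * (D / 4).natAbs)]
        exact Nat.even_iff.mp hn
      rw [if_pos hn, apply_eq_zero_of_even (χ := χ) hval, Int.cast_mul, Int.cast_zero, zero_mul]
    · rw [if_neg hn, hχ n (Nat.not_even_iff_odd.mp hn), Int.cast_mul]

/-! ### Square level: every imaginary quadratic twist prime to the level is odd -/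

/-- **At square level the twist always reverses the sign.** Assume the Modularity Theorem
(`exists_isNewformOf`). Let `E / ℚ` be elliptic with conductor `N = M²` a perfect square and `K`
an imaginary quadratic field with `(N, d_K) = 1`. Then `w(E^{(d_K)}) = −w(E)`: the sign of the
twisted functional equation is `w(E)·χ(−N)` (Murty–Murty 1997, Ch. 6 §1; Iwaniec 2006 (4.10):
«w(f_χ) = χ(−N)w(f)»), and
`χ(−N) = χ(−1)·χ(M)² = −1` because `χ = χ_{d_K}` is odd and quadratic and `M` is prime to its
modulus. Census reading: on a square level EVERY imaginary quadratic `d` prime to `N` lies in the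
favourable class `δ = 1` of the exponent law. [cite: MurtyMurty1997, Ch. 6 §1]
[cite: IwaniecConversations2006, (4.10)] -/
theorem rootNumber_quadraticTwist_discr_eq_neg_of_isSquare_conductorNorm
    (hmod : exists_isNewformOf) [W.IsElliptic] (h2 : Module.finrank ℚ K = 2)
    (hneg : NumberField.discr K < 0)
    (hcop : (W.conductorNorm ℤ).Coprime (NumberField.discr K).natAbs)
    (hsqN : IsSquare (W.conductorNorm ℤ)) :
    (W.quadraticTwist (NumberField.discr K : ℚ)).rootNumber = -W.rootNumber := by
  have hd : (NumberField.discr K : ℚ) ≠ 0 := by exact_mod_cast NumberField.discr_ne_zero K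
  haveI := W.isElliptic_quadraticTwist hd
  obtain ⟨m, _, χ, hNm, hq, hprim, hcoeff, hneg1⟩ :=
    exists_twistCharacter_of_coprime_discr W K h2 hneg hcop
  refine rootNumber_eq_neg_of_cuspCoeff_eq_twist W hmod hNm hq hprim _ hcoeff ?_
  obtain ⟨M, hM⟩ := hsqN
  have hMcop : M.Coprime m :=
    Nat.Coprime.coprime_dvd_left (⟨M, hM⟩ : M ∣ W.conductorNorm ℤ) hNm
  have hunit : IsUnit (M : ZMod m) := (ZMod.isUnit_iff_coprime M m).mpr hMcop
  have hχM : χ M * χ M = 1 := by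
    rcases hq (M : ZMod m) with h0 | h1 | h1
    · exact absurd h0 (hunit.map χ).ne_zero
    · rw [h1]; norm_num
    · rw [h1]; norm_num
  rw [hneg1, hM, Nat.cast_mul, map_mul, hχM]
  norm_num

/-! ### The exponent law -/

/-- `θ(D) > 0`: Iwaniec's mild factor `∏_{p ∣ D}(1 + 1/p)^{−3}(1 + 2√p/(p+1))^{−1}` is a finite
product of positive reals. [cite: IwaniecConversations2006, Thm 4.1] -/
theorem iwaniecTheta_pos (D : ℕ) : 0 < iwaniecTheta D := by
  unfold iwaniecTheta
  refine Finset.prod_pos fun p _ ↦ mul_pos ?_ ?_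
  · positivity
  · have : (0 : ℝ) < 1 + 2 * Real.sqrt p / ((p : ℝ) + 1) := by positivity
    positivity

/-- **The exponent law of the Goldfeld–Oesterlé–Iwaniec amplification** (census form
`E = r₀ + δ − 3`). Assume Iwaniec 2006 Thm 4.1 (`Iwaniec2006_theorem_4_1_weightTwo`) and the
Modularity Theorem (`exists_isNewformOf`, used only through the parity of `ord_{s=1} L(E^{(d)}, s)`,
which is in fact unconditional in the tree: `analyticRank_pos_of_rootNumber_eq_neg_one`). Let
`E / ℚ` be elliptic with `r₀ ≤ ord_{s=1} L(E, s)`, `(−1)^{r₀} = w(E)` and `r₀ ≥ 3`. Then there is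
`c = c(E, r₀) > 0` such that for every imaginary quadratic `K` with `(N_E, d_K) = 1`, `d = |d_K|`,
`h = h(−d)`, `θ = iwaniecTheta d`:
* if `w(E^{(d_K)}) = −1` (the favourable class, `δ = 1`): `c·θ·(log d)^{r₀ − 2} ≤ h`;
* if `w(E^{(d_K)}) = +1` (`δ = 0`): `c·θ·(log d)^{r₀ − 3} ≤ h`.
Derivation as printed: on the first class `L(s)` vanishes to order `m ≥ r₀ + 1` with total sign
`−w(E) = (−1)^{r₀+1}`, so Thm 4.1 applies with `g = m − 2 = r₀ − 1`; on the second to order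
`m ≥ r₀` with sign `(−1)^{r₀}`, `g = r₀ − 2`. (Goldfeld 1976 Thm 1 prints the same law as
`g − μ − 1`; Oesterlé 1985 is the case `r₀ = 3` on the first class, exponent `1`.)
[cite: IwaniecConversations2006, Thm 4.1] [cite: Goldfeld1976, Thm 1] [cite: Oesterle1985, Thm 1] -/
theorem le_classNumber_logPow_of_le_analyticRank (hIw : Iwaniec2006_theorem_4_1_weightTwo)
    [W.IsElliptic] {r₀ : ℕ} (h3 : 3 ≤ r₀) (hr : r₀ ≤ W.analyticRank)
    (hpar : (-1 : ℤ) ^ r₀ = W.rootNumber) :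
    ∃ c : ℝ, 0 < c ∧
      ∀ (K : Type) [Field K] [NumberField K],
        Module.finrank ℚ K = 2 → NumberField.discr K < 0 →
        (W.conductorNorm ℤ).Coprime (NumberField.discr K).natAbs →
        ((W.quadraticTwist (NumberField.discr K : ℚ)).rootNumber = -1 →
            c * iwaniecTheta (NumberField.discr K).natAbs *
                Real.log ((NumberField.discr K).natAbs : ℝ) ^ (r₀ - 2)
              ≤ (NumberField.classNumber K : ℝ)) ∧
        ((W.quadraticTwist (NumberField.discr K : ℚ)).rootNumber = 1 →
            c * iwaniecTheta (NumberField.discr K).natAbs *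
                Real.log ((NumberField.discr K).natAbs : ℝ) ^ (r₀ - 3)
              ≤ (NumberField.classNumber K : ℝ)) := by
  obtain ⟨c₁, hc₁, h₁⟩ := hIw W (r₀ + 1) (by omega)
  obtain ⟨c₀, hc₀, h₀⟩ := hIw W r₀ h3
  refine ⟨min c₁ c₀, lt_min hc₁ hc₀, fun K _ _ h2 hneg hcop ↦ ⟨fun hw' ↦ ?_, fun hw' ↦ ?_⟩⟩
  · -- favourable class: `m = r₀ + 1`, `g = r₀ - 1`
    have hd : (NumberField.discr K : ℚ) ≠ 0 := by exact_mod_cast NumberField.discr_ne_zero K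
    haveI := W.isElliptic_quadraticTwist hd
    have h1 : 1 ≤ (W.quadraticTwist (NumberField.discr K : ℚ)).analyticRank :=
      analyticRank_pos_of_rootNumber_eq_neg_one hw'
    have hsign : (-1 : ℤ) ^ (r₀ - 1) =
        W.rootNumber * (W.quadraticTwist (NumberField.discr K : ℚ)).rootNumber := by
      rw [hw', ← hpar]
      obtain ⟨k, rfl⟩ : ∃ k, r₀ = k + 1 := ⟨r₀ - 1, by omega⟩
      simp [pow_succ]
    have h := h₁ K h2 hneg hcop.symm (r₀ - 1) (by omega) (Or.inr (by omega)) hsign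
    have hlog : (0 : ℝ) ≤ Real.log ((NumberField.discr K).natAbs : ℝ) :=
      Real.log_natCast_nonneg _
    have hθ := iwaniecTheta_pos (NumberField.discr K).natAbs
    have hr2 : r₀ - 1 - 1 = r₀ - 2 := by omega
    rw [hr2] at h
    calc min c₁ c₀ * iwaniecTheta (NumberField.discr K).natAbs *
          Real.log ((NumberField.discr K).natAbs : ℝ) ^ (r₀ - 2)
        ≤ c₁ * iwaniecTheta (NumberField.discr K).natAbs *
          Real.log ((NumberField.discr K).natAbs : ℝ) ^ (r₀ - 2) := by
          gcongr
          exact min_le_left _ _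
      _ ≤ _ := h
  · -- other class: `m = r₀`, `g = r₀ - 2`
    have hsign : (-1 : ℤ) ^ (r₀ - 2) =
        W.rootNumber * (W.quadraticTwist (NumberField.discr K : ℚ)).rootNumber := by
      rw [hw', ← hpar, mul_one]
      obtain ⟨k, rfl⟩ : ∃ k, r₀ = k + 2 := ⟨r₀ - 2, by omega⟩
      simp [pow_succ]
    have h := h₀ K h2 hneg hcop.symm (r₀ - 2) (le_trans hr (Nat.le_add_right _ _))
      (Or.inr (by omega)) hsign
    have hlog : (0 : ℝ) ≤ Real.log ((NumberField.discr K).natAbs : ℝ) :=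
      Real.log_natCast_nonneg _
    have hθ := iwaniecTheta_pos (NumberField.discr K).natAbs
    have hr3 : r₀ - 2 - 1 = r₀ - 3 := by omega
    rw [hr3] at h
    calc min c₁ c₀ * iwaniecTheta (NumberField.discr K).natAbs *
          Real.log ((NumberField.discr K).natAbs : ℝ) ^ (r₀ - 3)
        ≤ c₀ * iwaniecTheta (NumberField.discr K).natAbs *
          Real.log ((NumberField.discr K).natAbs : ℝ) ^ (r₀ - 3) := by
          gcongr
          exact min_le_right _ _
      _ ≤ _ := h

/-! ### The target shapes of the census -/

/-- **Square level, provable analytic rank 4 ⇒ `(log d)²` for ALL coprime `d`.** Assume Iwaniec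
2006 Thm 4.1 and the Modularity Theorem. If ONE elliptic curve `E / ℚ` has square conductor
`N = M²`, root number `w(E) = +1` and `ord_{s=1} L(E, s) ≥ 4`, then there is an effectively
computable `c = c(E) > 0` with `c · θ(d) · (log d)² ≤ h(−d)` for every imaginary quadratic field of
discriminant `−d` prime to `N` — two logarithms above the theorem of record (Oesterlé 1985,
Thm 1: `ϑ(d) log d ≤ 55 h(−d)`), with no unfavourable class because every such twist is odd
(`rootNumber_quadraticTwist_discr_eq_neg_of_isSquare_conductorNorm`). The hypothesis
`4 ≤ analyticRank` is the uncertifiable input («`L″(E,1) = 0`», the analytic-rank-2 case of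
`rank ≤ analytic rank`); candidates with square conductor, `w = +1` and four independent rational
points exist (e.g. congruent-number curves `y² = x³ − n²x` of rank 4).
[cite: IwaniecConversations2006, Thm 4.1] [cite: Oesterle1985, Thm 1] -/
theorem le_classNumber_logSq_of_four_le_analyticRank_of_isSquare_conductorNorm
    (hIw : Iwaniec2006_theorem_4_1_weightTwo) (hmod : exists_isNewformOf) [W.IsElliptic]
    (hsqN : IsSquare (W.conductorNorm ℤ)) (hw : W.rootNumber = 1) (h4 : 4 ≤ W.analyticRank) :
    ∃ c : ℝ, 0 < c ∧
      ∀ (K : Type) [Field K] [NumberField K],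
        Module.finrank ℚ K = 2 → NumberField.discr K < 0 →
        (W.conductorNorm ℤ).Coprime (NumberField.discr K).natAbs →
        c * iwaniecTheta (NumberField.discr K).natAbs *
            Real.log ((NumberField.discr K).natAbs : ℝ) ^ 2
          ≤ (NumberField.classNumber K : ℝ) := by
  obtain ⟨c, hc, h⟩ := le_classNumber_logPow_of_le_analyticRank W hIw (r₀ := 4) (by norm_num) h4
    (by rw [hw]; norm_num)
  refine ⟨c, hc, fun K _ _ h2 hneg hcop ↦ ?_⟩
  have hw' := rootNumber_quadraticTwist_discr_eq_neg_of_isSquare_conductorNorm W K hmod h2 hneg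
    hcop hsqN
  rw [hw] at hw'
  exact (h K h2 hneg hcop).1 hw'

/-- **Any level, provable analytic rank 4, `w = +1`.** Assume Iwaniec 2006 Thm 4.1 and the
Modularity Theorem. If `E / ℚ` is elliptic with `w(E) = +1` and `ord_{s=1} L(E, s) ≥ 4`, then with
one constant `c = c(E) > 0`, for every imaginary quadratic `K` prime to `N_E`:
`c·θ(d)(log d)² ≤ h(−d)` when `w(E^{(d_K)}) = −1` (the class `χ_d(−N) = −1`; e.g. for the
rank-4 curve 234446a of squarefree conductor, half of the coprime discriminants), and
`c·θ(d)(log d) ≤ h(−d)` on the complementary class — the census row «`r = 4`: exponent `2` on the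
good half, `1` on the other». [cite: IwaniecConversations2006, Thm 4.1] [cite: Goldfeld1976, Thm 1] -/
theorem le_classNumber_logSq_of_four_le_analyticRank (hIw : Iwaniec2006_theorem_4_1_weightTwo)
    [W.IsElliptic] (hw : W.rootNumber = 1) (h4 : 4 ≤ W.analyticRank) :
    ∃ c : ℝ, 0 < c ∧
      ∀ (K : Type) [Field K] [NumberField K],
        Module.finrank ℚ K = 2 → NumberField.discr K < 0 →
        (W.conductorNorm ℤ).Coprime (NumberField.discr K).natAbs →
        ((W.quadraticTwist (NumberField.discr K : ℚ)).rootNumber = -1 →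
            c * iwaniecTheta (NumberField.discr K).natAbs *
                Real.log ((NumberField.discr K).natAbs : ℝ) ^ 2
              ≤ (NumberField.classNumber K : ℝ)) ∧
        ((W.quadraticTwist (NumberField.discr K : ℚ)).rootNumber = 1 →
            c * iwaniecTheta (NumberField.discr K).natAbs *
                Real.log ((NumberField.discr K).natAbs : ℝ)
              ≤ (NumberField.classNumber K : ℝ)) := by
  obtain ⟨c, hc, h⟩ := le_classNumber_logPow_of_le_analyticRank W hIw (r₀ := 4) (by norm_num) h4
    (by rw [hw]; norm_num)
  refine ⟨c, hc, fun K _ _ h2 hneg hcop ↦ ⟨fun hw' ↦ (h K h2 hneg hcop).1 hw', fun hw' ↦ ?_⟩⟩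
  simpa using (h K h2 hneg hcop).2 hw'

/-- **Any level, provable analytic rank 5 (`w = −1`) ⇒ `(log d)²` for all coprime `d`.** Assume
Iwaniec 2006 Thm 4.1 and the Modularity Theorem. If `E / ℚ` is elliptic with `w(E) = −1` and
`ord_{s=1} L(E, s) ≥ 5`, then `c·θ(d)(log d)² ≤ h(−d)` for every imaginary quadratic `d` prime to
`N_E` (exponent `3` on the class `w(E^{(d)}) = −1`, `2` on the other; `log d ≥ 1` as `d ≥ 3`).
No curve with five independent points has a certified analytic rank `≥ 5` (the certificate
ladder stops at the first derivative); recorded as the second target shape of the census.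
[cite: IwaniecConversations2006, Thm 4.1] -/
theorem le_classNumber_logSq_of_five_le_analyticRank (hIw : Iwaniec2006_theorem_4_1_weightTwo)
    [W.IsElliptic] (hw : W.rootNumber = -1) (h5 : 5 ≤ W.analyticRank) :
    ∃ c : ℝ, 0 < c ∧
      ∀ (K : Type) [Field K] [NumberField K],
        Module.finrank ℚ K = 2 → NumberField.discr K < 0 →
        (W.conductorNorm ℤ).Coprime (NumberField.discr K).natAbs →
        c * iwaniecTheta (NumberField.discr K).natAbs *
            Real.log ((NumberField.discr K).natAbs : ℝ) ^ 2
          ≤ (NumberField.classNumber K : ℝ) := by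
  obtain ⟨c, hc, h⟩ := le_classNumber_logPow_of_le_analyticRank W hIw (r₀ := 5) (by norm_num) h5
    (by rw [hw]; norm_num)
  refine ⟨c, hc, fun K _ _ h2 hneg hcop ↦ ?_⟩
  have hd : (NumberField.discr K : ℚ) ≠ 0 := by exact_mod_cast NumberField.discr_ne_zero K
  haveI := W.isElliptic_quadraticTwist hd
  have hθ := iwaniecTheta_pos (NumberField.discr K).natAbs
  -- `log d ≥ 1` since `d = |d_K| ≥ 3 > e`
  have hd3 : (3 : ℝ) ≤ ((NumberField.discr K).natAbs : ℝ) := by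
    have := NumberField.abs_discr_gt_two (K := K) (by rw [h2]; exact one_lt_two)
    have h3 : (3 : ℤ) ≤ (NumberField.discr K).natAbs := by
      rw [Int.natCast_natAbs]; exact this
    exact_mod_cast h3
  have hlog1 : (1 : ℝ) ≤ Real.log ((NumberField.discr K).natAbs : ℝ) := by
    rw [← Real.log_exp 1]
    refine Real.log_le_log (Real.exp_pos 1) (le_trans ?_ hd3)
    have := Real.exp_one_lt_d9
    norm_num at this ⊢
    linarith
  rcases (W.quadraticTwist (NumberField.discr K : ℚ)).rootNumber_eq_one_or with hw' | hw'
  · simpa using (h K h2 hneg hcop).2 hw'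
  · have h3 := (h K h2 hneg hcop).1 hw'
    calc c * iwaniecTheta (NumberField.discr K).natAbs *
          Real.log ((NumberField.discr K).natAbs : ℝ) ^ 2
        ≤ c * iwaniecTheta (NumberField.discr K).natAbs *
          Real.log ((NumberField.discr K).natAbs : ℝ) ^ (5 - 2) := by
          have hcθ : 0 ≤ c * iwaniecTheta (NumberField.discr K).natAbs := by positivity
          refine mul_le_mul_of_nonneg_left ?_ hcθ
          exact pow_le_pow_right₀ hlog1 (by norm_num)
      _ ≤ _ := h3

end Literature.NumberTheory.QuadraticFields

end
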